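import Summits.CriticalPhenomena.PercolationContinuityZ3.Theorems.PercAnnulusCrossingIICAnnulusDomination
import Summits.CriticalPhenomena.PercolationContinuityZ3.Theorems.PercAnnulusCrossingIICChemicalExponentDeterministic
import Summits.CriticalPhenomena.PercolationContinuityZ3.Theorems.PercAnnulusCrossingIICUniquenessJunk
import HarnessLib

/-!
# Short annulus crossings and the chemical exponent of Kesten's IIC: summable short-crossing bounds ⇒ `α⁻ ≥ σ` a.s. (lane RSW3, p1 gen 15)

builds on p205010 (kernel theorem, internal audit signed; external expert review pending) — used in the `criticalProbI` statements (gen 15's annulus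
domination and gen 14's chemical exponents); the deterministic lemmas and the `ℤ²` statement do not use it beyond that.

Seat `prim-rsw3-p1` (gen 15); memo `run/shared/lean/prim/rsw3/P1-QM.md` §28.  Helper file for the crux `stmt-CriticalPhenomena-4575`
chain; no definitions, no sorries.  The first consumer of gen 15's TRANSFER PRINCIPLE (`…IICAnnulusDomination`): a geodesic of the IIC from the root to
`Λ(N)ᶜ` of length `D_N ≤ ℓ` contains, between its last visit to `Λ(n)` and its first exit from `Λ(N)`, an open crossing of the annulus `Λ(N) ∖ Λ(n)` of
length `≤ ℓ` using only pairs of the annulus — the SHORT-CROSSING event `S(n,N,ℓ) = {∃ a ∈ ∂ⁱⁿΛ(n+1), v ∈ ∂ⁱⁿΛ(N) : dist_{ω ∩ (Λ(N)∖Λ(n)).sym2}(a,v) ≤ ℓ}`,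
an annulus event.  So `ν(D_N ≤ ℓ) ≤ C·A·P_{p_c}(S(n,N,ℓ))` for `N ≤ 2n`, and a summable bound on short crossings of critical annuli transfers to an
almost-sure LOWER bound on the chemical exponent of the IIC:

* `measurableSet_shortCrossing`, `determinedBy_shortCrossing` — `S(n,N,ℓ)` is measurable and determined by the pairs of `Λ(N) ∖ Λ(n)`;
* **`shortCrossing_of_iInf_edist_le`** (deterministic) — `D_N ≤ ℓ`, `n + 1 < N`, `0` percolating ⇒ `ω ∈ S(n,N,ℓ)`;
* **`iicMeasure_real_chemical_le_le_criticalProbI`** — `ν(D_N ≤ ℓ) ≤ C·A·P_{p_c}(S(n,N,ℓ))` for `1 ≤ n`, `n + 1 < N ≤ 2n` ((A2)□ at `p_c(ℤ^d)`);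
* **`iicMeasure_chemical_exponent_ge_of_summable_shortCrossings`** — if `Σ_j P_{p_c}(S(2^j, 2^{j+1}, ⌊(2^{j+1})^σ⌋)) < ∞` for some real `σ > 0`, then the
  deterministic lower chemical exponent of the IIC satisfies **`α⁻ ≥ σ`** (`D_n` is monotone in `n`); **`…_Z2`** unconditionally in the IIC hypotheses.
READING: Aizenman–Burchard's tortuosity bound for planar critical percolation (Duke Math. J. 99 (1999), Thm. 1.3: crossings of macroscopic annuli are longer
than `n^{s}` for some `s > 1`, with summable failure probabilities) is exactly a hypothesis of this form; it is NOT in the tree, so the planar conclusion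
`α⁻ > 1` for Kesten's IIC is recorded here only as the implication.
References: M. Aizenman, A. Burchard, Duke Math. J. 99 (1999) 419–453, Thm. 1.3; H. Kesten, PTRF 73 (1986), §2; G. Grimmett, *Percolation* (1999), §2.2.
-/

noncomputable section

namespace Summit.CriticalPhenomena.PercolationContinuityZ3.Theorems.Crossing

open MeasureTheory ProbabilityTheory Filter Topology
open Literature.Probability.Percolation Literature.Probability.LatticeModels
open Literature.Probability.Percolation.DCT16
open Literature.Barriers.CriticalPhenomena
open Summit.CriticalPhenomena.PercolationContinuityZ3.Theorems.SurfaceTension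
open scoped ENNReal ProbabilityTheory Literature.Probability.Percolation

variable {d : ℕ}

/-! ## The short-crossing event of an annulus -/

/-- The short-crossing event `S(n,N,ℓ)` is measurable. [folklore] -/
theorem measurableSet_shortCrossing (n N ℓ : ℕ) :
    MeasurableSet {ω : BondConfig (Site d) | ∃ a ∈ innerBoundary (zdGraph d) (box d (n + 1)), ∃ v ∈ innerBoundary (zdGraph d) (box d N),
      (openGraph (ω ∩ ((↑(box d N) : Set (Site d)) \ ↑(box d n)).sym2)).edist a v ≤ ℓ} := by
  set E : Set (Sym2 (Site d)) := ((↑(box d N) : Set (Site d)) \ ↑(box d n)).sym2 with hE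
  have hinter : (fun ω : BondConfig (Site d) => ω ∩ E) = fun ω => ω \ Eᶜ := by
    funext ω; ext e; simp only [Set.mem_inter_iff, Set.mem_sdiff, Set.mem_compl_iff, not_not]
  have h : {ω : BondConfig (Site d) | ∃ a ∈ innerBoundary (zdGraph d) (box d (n + 1)), ∃ v ∈ innerBoundary (zdGraph d) (box d N),
      (openGraph (ω ∩ E)).edist a v ≤ ℓ} = ⋃ a ∈ innerBoundary (zdGraph d) (box d (n + 1)), ⋃ v ∈ innerBoundary (zdGraph d) (box d N),
      (fun ω : BondConfig (Site d) => ω ∩ E) ⁻¹' {η | (openGraph η).edist a v ≤ ℓ} := by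
    ext ω; simp only [Set.mem_setOf_eq, Set.mem_iUnion, Set.mem_preimage, exists_prop]
  rw [h]
  refine Finset.measurableSet_biUnion _ fun a _ => Finset.measurableSet_biUnion _ fun v _ => ?_
  rw [hinter]
  exact measurable_sdiff_touching Eᶜ (measurableSet_edist_le a v ℓ)

/-- The short-crossing event `S(n,N,ℓ)` is determined by the pairs of the annulus `Λ(N) ∖ Λ(n)`. [folklore] -/
theorem determinedBy_shortCrossing (n N ℓ : ℕ) :
    DeterminedBy {ω : BondConfig (Site d) | ∃ a ∈ innerBoundary (zdGraph d) (box d (n + 1)), ∃ v ∈ innerBoundary (zdGraph d) (box d N),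
      (openGraph (ω ∩ ((↑(box d N) : Set (Site d)) \ ↑(box d n)).sym2)).edist a v ≤ ℓ}
      (((↑(box d N) : Set (Site d)) \ ↑(box d n)).sym2) := by
  rw [determinedBy_iff]
  intro ω ω' h
  simp only [Set.mem_setOf_eq, h]

/-- The pairs of the annulus lie in `Λ(N).sym2` and avoid `Λ(n).sym2`. [folklore] -/
theorem annulusPairs_subset_disjoint (n N : ℕ) :
    ((↑(box d N) : Set (Site d)) \ ↑(box d n)).sym2 ⊆ (↑((box d N).sym2) : Set (Sym2 (Site d))) ∧
      Disjoint (↑((box d n).sym2) : Set (Sym2 (Site d))) (((↑(box d N) : Set (Site d)) \ ↑(box d n)).sym2) := by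
  constructor
  · intro e he
    rw [Finset.coe_sym2]
    induction e using Sym2.ind with
    | _ x y =>
      rw [Set.mk_mem_sym2_iff] at he ⊢
      exact ⟨he.1.1, he.2.1⟩
  · refine Set.disjoint_left.2 fun e he he' => ?_
    rw [Finset.coe_sym2] at he
    induction e using Sym2.ind with
    | _ x y =>
      rw [Set.mk_mem_sym2_iff] at he he'
      exact he'.1.2 he.1

/-! ## A short geodesic produces a short annulus crossing -/

/-- **A short geodesic to `Λ(N)ᶜ` contains a short crossing of `Λ(N) ∖ Λ(n)`** (deterministic, lattice configurations, `n + 1 < N`): if `0` is joined to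
a site outside `Λ(N)` by an open walk of length `≤ ℓ`, then some `a ∈ ∂ⁱⁿΛ(n+1)` and `v ∈ ∂ⁱⁿΛ(N)` are at distance `≤ ℓ` in the open graph of the pairs
of `Λ(N) ∖ Λ(n)` (the segment of the walk after its last visit to `Λ(n)` up to its first exit from `Λ(N)`). [cite: Kesten1986, §2] -/
theorem shortCrossing_of_walk {ω : BondConfig (Site d)} (hω : ω ⊆ (zdGraph d).edgeSet) {n N ℓ : ℕ} (hnN : n + 1 < N)
    {w : Site d} (hw : w ∉ box d N) (p : (openGraph ω).Walk (0 : Site d) w) (hp : p.length ≤ ℓ) :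
    ω ∈ {ω : BondConfig (Site d) | ∃ a ∈ innerBoundary (zdGraph d) (box d (n + 1)), ∃ v ∈ innerBoundary (zdGraph d) (box d N),
      (openGraph (ω ∩ ((↑(box d N) : Set (Site d)) \ ↑(box d n)).sym2)).edist a v ≤ ℓ} := by
  classical
  set E : Set (Sym2 (Site d)) := ((↑(box d N) : Set (Site d)) \ ↑(box d n)).sym2 with hE
  -- last visit to `Λ(n)`: cut the reversed walk at its first entry into `Λ(n)`
  have h0n : (0 : Site d) ∉ (↑(box d n) : Set (Site d))ᶜ := fun h => h (Finset.mem_coe.2 (zero_mem_box d n))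
  have hwn : w ∈ (↑(box d n) : Set (Site d))ᶜ := fun h => hw (box_mono d (by omega) (Finset.mem_coe.1 h))
  obtain ⟨a₃, c₃, q₃, r₃, hac₃, ha₃, hc₃, hq₃B, -, -, hedges₃⟩ := exists_cut_walk_edge ((↑(box d n) : Set (Site d))ᶜ) p.reverse hwn h0n
  -- `a₃ ∈ ∂ⁱⁿΛ(n+1)`
  have hc₃' : c₃ ∈ box d n := by by_contra h'; exact hc₃ fun h'' => h' (Finset.mem_coe.1 h'')
  have ha₃' : a₃ ∈ box d (n + 1) := mem_box_succ_of_adj_box (adj_of_openGraph_adj hω hac₃).symm hc₃'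
  have ha₃B : a₃ ∈ innerBoundary (zdGraph d) (box d (n + 1)) := mem_innerBoundary_box_of_notMem_pred (by omega) ha₃' (by simpa using ha₃)
  have hq₃len : q₃.length ≤ ℓ := by
    have h1 : p.reverse.edges.length = q₃.edges.length + (s(a₃, c₃) :: r₃.edges).length := by rw [hedges₃, List.length_append]
    simp only [SimpleGraph.Walk.length_edges, SimpleGraph.Walk.length_reverse, List.length_cons] at h1
    omega
  -- first exit from `Λ(N)` of the walk `a₃ → w` (which avoids `Λ(n)`)
  have ha₃N : a₃ ∈ (↑(box d N) : Set (Site d)) := Finset.mem_coe.2 (box_mono d (by omega) ha₃')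
  have hwN : w ∉ (↑(box d N) : Set (Site d)) := fun h => hw (Finset.mem_coe.1 h)
  obtain ⟨a', b', q', r', hab', ha', hb', hq'B, hq'p, -, hedges'⟩ := exists_cut_walk_edge (↑(box d N) : Set (Site d)) q₃.reverse ha₃N hwN
  have ha'B : a' ∈ innerBoundary (zdGraph d) (box d N) :=
    mem_innerBoundary_iff.2 ⟨Finset.mem_coe.1 ha', b', fun h => hb' (Finset.mem_coe.2 h), adj_of_openGraph_adj hω hab'⟩
  have hq'len : q'.length ≤ ℓ := by
    have h1 : q₃.reverse.edges.length = q'.edges.length + (s(a', b') :: r'.edges).length := by rw [hedges', List.length_append]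
    simp only [SimpleGraph.Walk.length_edges, SimpleGraph.Walk.length_reverse, List.length_cons] at h1
    omega
  -- the walk `q'` lives in the annulus, so its edges are pairs of the annulus
  have hsupp : ∀ z ∈ q'.support, z ∈ (↑(box d N) : Set (Site d)) \ ↑(box d n) := by
    intro z hz
    refine ⟨hq'B z hz, ?_⟩
    have hz' := hq'p z hz
    rw [SimpleGraph.Walk.support_reverse, List.mem_reverse] at hz'
    exact hq₃B z hz'
  have htransfer : ∀ e, e ∈ q'.edges → e ∈ (openGraph (ω ∩ E)).edgeSet := by
    intro e he
    induction e using Sym2.ind with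
    | _ x y =>
      have hadj : (openGraph ω).Adj x y := q'.adj_of_mem_edges he
      have hxy := (openGraph_adj ω x y).1 hadj
      have hx : x ∈ q'.support := q'.fst_mem_support_of_mem_edges he
      have hy : y ∈ q'.support := q'.snd_mem_support_of_mem_edges he
      rw [SimpleGraph.mem_edgeSet, openGraph_adj]
      exact ⟨⟨hxy.1, Set.mk_mem_sym2_iff.2 ⟨hsupp x hx, hsupp y hy⟩⟩, hxy.2⟩
  refine ⟨a₃, ha₃B, a', ha'B, ?_⟩
  calc (openGraph (ω ∩ E)).edist a₃ a' ≤ (q'.transfer (openGraph (ω ∩ E)) htransfer).length := SimpleGraph.Walk.edist_le _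
    _ = q'.length := by rw [SimpleGraph.Walk.length_transfer]
    _ ≤ ℓ := by exact_mod_cast hq'len

/-- **`D_N ≤ ℓ` forces a short annulus crossing** (lattice configurations in which `0` percolates, `n + 1 < N`): if the chemical distance from the root to
`Λ(N)ᶜ` is at most `ℓ`, then `ω ∈ S(n,N,ℓ)`. [cite: Kesten1986, §2] -/
theorem shortCrossing_of_iInf_edist_le {ω : BondConfig (Site d)} (hω : ω ⊆ (zdGraph d).edgeSet)
    (h0 : ω ∈ (percolatesAt (0 : Site d) : Set (BondConfig (Site d)))) {n N ℓ : ℕ} (hnN : n + 1 < N)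
    (hD : (⨅ v : {v : Site d // v ∉ box d N}, (openGraph ω).edist (0 : Site d) v.1) ≤ ℓ) :
    ω ∈ {ω : BondConfig (Site d) | ∃ a ∈ innerBoundary (zdGraph d) (box d (n + 1)), ∃ v ∈ innerBoundary (zdGraph d) (box d N),
      (openGraph (ω ∩ ((↑(box d N) : Set (Site d)) \ ↑(box d n)).sym2)).edist a v ≤ ℓ} := by
  classical
  have hexit : ∃ v : Site d, v ∉ box d N ∧ (openGraph ω).Reachable 0 v := by
    by_contra hcon
    push Not at hcon
    exact h0 ((box d N).finite_toSet.subset fun z hz => Finset.mem_coe.2 (by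
      by_contra hzn; exact hcon z hzn hz))
  obtain ⟨v₀, hv₀, -⟩ := hexit
  haveI : Nonempty {v : Site d // v ∉ box d N} := ⟨⟨v₀, hv₀⟩⟩
  obtain ⟨⟨v, hv⟩, hvD⟩ := exists_eq_iInf_enat (fun v : {v : Site d // v ∉ box d N} => (openGraph ω).edist (0 : Site d) v.1)
  have hvD' : (openGraph ω).edist 0 v ≤ ℓ := by rw [show (openGraph ω).edist 0 v = _ from hvD]; exact hD
  have hfin : (openGraph ω).edist 0 v ≠ ⊤ := ne_top_of_le_ne_top (ENat.coe_ne_top ℓ) hvD'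
  obtain ⟨p, hp⟩ := SimpleGraph.exists_walk_of_edist_ne_top hfin
  have hplen : p.length ≤ ℓ := by
    have : (p.length : ℕ∞) ≤ ℓ := hp ▸ hvD'
    exact_mod_cast this
  exact shortCrossing_of_walk hω hnN hv p hplen

/-! ## The IIC: `ν(D_N ≤ ℓ) ≤ C·A·P_{p_c}(S(n,N,ℓ))` -/

/-- **Short geodesics of the IIC are as rare as short crossings of critical annuli** (`p_c(ℤ^d)`, `d ≥ 2`, (A2)□ at aspect `(s,L)`, `2 ≤ s ≤ L`): with the
constants `C, A` of gen 15's annulus domination, for every measure `ν` with Kesten's IIC limit property, all `1 ≤ n`, `n + 1 < N ≤ 2n` and all `ℓ`: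
`ν(D_N ≤ ℓ) ≤ C·A·P_{p_c}(S(n,N,ℓ))`. [cite: Kesten1986, §2 eq. (2.22)] [cite: BasuSapozhnikov2017ECP, §2 (2.5)] -/
theorem iicMeasure_real_chemical_le_le_criticalProbI (hd : 2 ≤ d) {s L : ℕ} (hs : 2 ≤ s) (hsL : s ≤ L) {ϰ : ℝ} (hϰ : 0 < ϰ)
    (hA2 : SetToSetQuasiMultAspectAt d (criticalProbI d) s L ϰ) :
    ∃ C : ℝ, 0 < C ∧ ∀ (ν : Measure (BondConfig (Site d))) [IsProbabilityMeasure ν],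
      (∀ (F : Finset (Sym2 (Site d))) (E : Set (BondConfig (Site d))), MeasurableSet E → DeterminedBy E ↑F →
        Tendsto (fun n : ℕ => (bondPercolation (zdGraph d) (criticalProbI d)).real (E ∩ siteToBoundary d n) /
          oneArmProb d (criticalProbI d) n) atTop (𝓝 (ν.real E))) →
      ∀ (n N ℓ : ℕ), 1 ≤ n → n + 1 < N → N ≤ 2 * n →
        ν.real {ω | (⨅ v : {v : Site d // v ∉ box d N}, (openGraph ω).edist (0 : Site d) v.1) ≤ ℓ} ≤
          C * (bondPercolation (zdGraph d) (criticalProbI d)).real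
            {ω : BondConfig (Site d) | ∃ a ∈ innerBoundary (zdGraph d) (box d (n + 1)), ∃ v ∈ innerBoundary (zdGraph d) (box d N),
              (openGraph (ω ∩ ((↑(box d N) : Set (Site d)) \ ↑(box d n)).sym2)).edist a v ≤ ℓ} := by
  have hd1 : 1 ≤ d := by omega
  have hpc : 0 < ((criticalProbI d : unitInterval) : ℝ) := by rw [coe_criticalProbI]; exact criticalProb_zd_pos d hd1
  obtain ⟨C, A, hC, hA, hdom⟩ := iicMeasure_real_le_annulus_criticalProbI hd hs hsL hϰ hA2
  refine ⟨C * A, by positivity, fun ν _ hν n N ℓ hn hnN hN2 => ?_⟩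
  obtain ⟨hsub, hdisj⟩ := annulusPairs_subset_disjoint (d := d) n N
  have h1 : ν.real {ω | (⨅ v : {v : Site d // v ∉ box d N}, (openGraph ω).edist (0 : Site d) v.1) ≤ ℓ} ≤
      ν.real {ω : BondConfig (Site d) | ∃ a ∈ innerBoundary (zdGraph d) (box d (n + 1)), ∃ v ∈ innerBoundary (zdGraph d) (box d N),
        (openGraph (ω ∩ ((↑(box d N) : Set (Site d)) \ ↑(box d n)).sym2)).edist a v ≤ ℓ} := by
    refine ENNReal.toReal_mono (measure_ne_top _ _) (measure_mono_ae ?_)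
    filter_upwards [iicMeasure_ae_subset_edgeSet (criticalProbI d) hν, iicMeasure_ae_percolatesAt hd1 (criticalProbI d) hpc hν] with ω hω h0 hD
    exact shortCrossing_of_iInf_edist_le hω h0 hnN hD
  have h2 := hdom ν hν 1 n N hn (by omega) (by omega) _ hsub hdisj _ (determinedBy_shortCrossing n N ℓ) (measurableSet_shortCrossing n N ℓ)
  rw [pow_one] at h2
  exact h1.trans h2

/-! ## Summable short-crossing bounds ⇒ a lower bound on the chemical exponent -/

/-- **TRANSFER: SUMMABLE SHORT-CROSSING BOUNDS FOR CRITICAL ANNULI ⇒ `α⁻ ≥ σ` FOR KESTEN'S IIC** (`p_c(ℤ^d)`, `d ≥ 2`, (A2)□ at aspect `(s,L)`,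
`2 ≤ s ≤ L`): if for some real `σ > 0` the critical probabilities of a short crossing `S(2^j, 2^{j+1}, ⌊(2^{j+1})^σ⌋)` of the dyadic annuli are
summable in `j`, then the deterministic lower chemical exponent `α⁻ = liminf log D_n/log(n+2)` (gen 14) satisfies `ENNReal.ofReal σ ≤ α⁻`.
(Aizenman–Burchard's planar tortuosity theorem is a hypothesis of this form with some `σ > 1`; it is not in the tree.)
[cite: Kesten1986, Thm. (3)] [cite: AizenmanBurchard1999, Thm. 1.3] [cite: Georgii2011, Prop. 7.9] -/
theorem iicMeasure_chemical_exponent_ge_of_summable_shortCrossings (hd : 2 ≤ d) {s L : ℕ} (hs : 2 ≤ s) (hsL : s ≤ L) {ϰ : ℝ} (hϰ : 0 < ϰ)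
    (hA2 : SetToSetQuasiMultAspectAt d (criticalProbI d) s L ϰ) {σ : ℝ} (hσ : 0 < σ)
    (hsum : Summable fun j : ℕ => (bondPercolation (zdGraph d) (criticalProbI d)).real
      {ω : BondConfig (Site d) | ∃ a ∈ innerBoundary (zdGraph d) (box d (2 ^ j + 1)), ∃ v ∈ innerBoundary (zdGraph d) (box d (2 ^ (j + 1))),
        (openGraph (ω ∩ ((↑(box d (2 ^ (j + 1))) : Set (Site d)) \ ↑(box d (2 ^ j))).sym2)).edist a v ≤ ⌊((2 : ℝ) ^ (j + 1)) ^ σ⌋₊})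
    {ν : Measure (BondConfig (Site d))} [IsProbabilityMeasure ν]
    (hν : ∀ (F : Finset (Sym2 (Site d))) (E : Set (BondConfig (Site d))), MeasurableSet E → DeterminedBy E ↑F →
      Tendsto (fun n : ℕ => (bondPercolation (zdGraph d) (criticalProbI d)).real (E ∩ siteToBoundary d n) /
        oneArmProb d (criticalProbI d) n) atTop (𝓝 (ν.real E))) :
    ∃ αl : ℝ≥0∞, ENNReal.ofReal σ ≤ αl ∧ ∀ᵐ ω ∂ν,
      liminf (fun n => ENNReal.ofReal
        (Real.log (((⨅ v : {v : Site d // v ∉ box d n}, (openGraph ω).edist (0 : Site d) v.1).toNat : ℕ) : ℝ) /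
          Real.log ((n : ℝ) + 2))) atTop = αl := by
  classical
  obtain ⟨αl, αu, -, -, -, hae⟩ := iicMeasure_chemical_exponents_criticalProbI hd hs hsL hϰ hA2 hν
  obtain ⟨C, hC, hcmp⟩ := iicMeasure_real_chemical_le_le_criticalProbI hd hs hsL hϰ hA2
  -- Borel–Cantelli along the dyadic scales `N_j = 2^{j+2}`, inner boxes `Λ(2^{j+1})`
  set Dset : ℕ → Set (BondConfig (Site d)) := fun j =>
    {ω | (⨅ v : {v : Site d // v ∉ box d (2 ^ (j + 2))}, (openGraph ω).edist (0 : Site d) v.1) ≤ ⌊((2 : ℝ) ^ (j + 2)) ^ σ⌋₊} with hDset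
  have hBC : ∀ᵐ ω ∂ν, ∀ᶠ j in atTop, ω ∉ Dset j := by
    refine ae_eventually_not_mem_of_real_le ν Dset (fun j => C * (bondPercolation (zdGraph d) (criticalProbI d)).real
      {ω : BondConfig (Site d) | ∃ a ∈ innerBoundary (zdGraph d) (box d (2 ^ (j + 1) + 1)),
        ∃ v ∈ innerBoundary (zdGraph d) (box d (2 ^ (j + 1 + 1))),
        (openGraph (ω ∩ ((↑(box d (2 ^ (j + 1 + 1))) : Set (Site d)) \ ↑(box d (2 ^ (j + 1)))).sym2)).edist a v ≤
          ⌊((2 : ℝ) ^ (j + 1 + 1)) ^ σ⌋₊}) (fun j => mul_nonneg hC.le measureReal_nonneg)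
      (((summable_nat_add_iff 1).2 hsum).mul_left C) fun j => ?_
    have h2j : 1 ≤ 2 ^ (j + 1) := Nat.one_le_two_pow
    have := hcmp ν hν (2 ^ (j + 1)) (2 ^ (j + 2)) ⌊((2 : ℝ) ^ (j + 2)) ^ σ⌋₊ h2j
      (by rw [pow_succ 2 (j + 1)]; omega) (by rw [pow_succ 2 (j + 1)]; omega)
    simpa only [hDset, show j + 1 + 1 = j + 2 by ring] using this
  refine ⟨αl, ?_, hae.mono fun ω h => h.1⟩
  obtain ⟨ω, hω, hωBC, hDV⟩ := (hae.and (hBC.and (iicMeasure_ae_chemical_le_volume (by omega) (criticalProbI d)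
    (by rw [coe_criticalProbI]; exact criticalProb_zd_pos d (by omega)) hν))).exists
  rw [← hω.1]
  set D : ℕ → ℕ := fun n => (⨅ v : {v : Site d // v ∉ box d n}, (openGraph ω).edist (0 : Site d) v.1).toNat with hD
  have hfin : ∀ m : ℕ, (⨅ v : {v : Site d // v ∉ box d m}, (openGraph ω).edist (0 : Site d) v.1) ≠ ⊤ := by
    intro m htop
    have h := (hDV m).1
    simp only [htop, ENat.toNat_top] at h
    omega
  -- `D` is monotone in `n` (fewer admissible endpoints)
  have hDmono : ∀ {m n : ℕ}, m ≤ n → D m ≤ D n := by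
    intro m n hmn
    have hle : (⨅ v : {v : Site d // v ∉ box d m}, (openGraph ω).edist (0 : Site d) v.1) ≤
        ⨅ v : {v : Site d // v ∉ box d n}, (openGraph ω).edist (0 : Site d) v.1 :=
      le_iInf fun v => iInf_le (fun v : {v : Site d // v ∉ box d m} => (openGraph ω).edist (0 : Site d) v.1)
        ⟨v.1, fun h => v.2 (box_mono d hmn h)⟩
    exact ENat.toNat_le_toNat hle (hfin n)
  -- eventually (in `j`): `D (2^{j+2}) > ⌊(2^{j+2})^σ⌋`
  obtain ⟨j₀, hj₀⟩ := hωBC.exists_forall_of_atTop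
  have hbig : ∀ j, j₀ ≤ j → ((2 : ℝ) ^ (j + 2)) ^ σ ≤ (D (2 ^ (j + 2)) : ℝ) := by
    intro j hj
    have h := hj₀ j hj
    simp only [hDset, Set.mem_setOf_eq, not_le] at h
    have h' : ⌊((2 : ℝ) ^ (j + 2)) ^ σ⌋₊ < D (2 ^ (j + 2)) := by
      have := h
      rw [← ENat.coe_toNat (hfin (2 ^ (j + 2)))] at this
      exact_mod_cast this
    have := Nat.lt_of_floor_lt h'
    exact this.le
  -- conclude `ofReal σ ≤ liminf`
  refine ENNReal.le_of_forall_pos_le_add fun ε hε _ => ?_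
  have hε' : (0 : ℝ) < ε := NNReal.coe_pos.2 hε
  have hlog : Tendsto (fun n : ℕ => Real.log ((n : ℝ) + 2)) atTop atTop :=
    Real.tendsto_log_atTop.comp (tendsto_atTop_add_const_right _ _ tendsto_natCast_atTop_atTop)
  have hsplit : ENNReal.ofReal σ ≤ ENNReal.ofReal (σ - ε) + ε := by
    calc ENNReal.ofReal σ = ENNReal.ofReal ((σ - ε) + ε) := by rw [sub_add_cancel]
      _ ≤ ENNReal.ofReal (σ - ε) + ENNReal.ofReal (ε : ℝ) := ENNReal.ofReal_add_le
      _ = ENNReal.ofReal (σ - ε) + ε := by rw [ENNReal.ofReal_coe_nnreal]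
  refine hsplit.trans (add_le_add ?_ le_rfl)
  refine le_liminf_of_le (by isBoundedDefault) ?_
  -- for large `n`: with `2^{j+2} ≤ n < 2^{j+3}`, `D n ≥ D (2^{j+2}) ≥ (2^{j+2})^σ ≥ (n/2)^σ`
  have hev : ∀ᶠ n : ℕ in atTop, 2 ^ (j₀ + 2) ≤ n ∧ σ * (1 + Real.log 2) ≤ ε * Real.log ((n : ℝ) + 2) :=
    (eventually_ge_atTop _).and ((hlog.const_mul_atTop hε').eventually_ge_atTop _)
  filter_upwards [hev] with n hn
  obtain ⟨hn₀, hnε⟩ := hn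
  have hn1 : 1 ≤ n := le_trans Nat.one_le_two_pow hn₀
  have hnr : (1 : ℝ) ≤ n := by exact_mod_cast hn1
  have hlog2 : 0 < Real.log ((n : ℝ) + 2) := Real.log_pos (by linarith)
  -- the dyadic index of `n`
  set j := Nat.log 2 n - 2 with hj
  have hlogn : j₀ + 2 ≤ Nat.log 2 n := Nat.le_log_of_pow_le (by norm_num) hn₀
  have hj₀j : j₀ ≤ j := by omega
  have hpow_le : 2 ^ (j + 2) ≤ n := by
    have : j + 2 = Nat.log 2 n := by omega
    rw [this]; exact Nat.pow_log_le_self 2 (by omega)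
  have hn_lt : n < 2 ^ (j + 3) := by
    have : j + 3 = Nat.log 2 n + 1 := by omega
    rw [this]; exact Nat.lt_pow_succ_log_self (by norm_num) n
  have hDn : ((2 : ℝ) ^ (j + 2)) ^ σ ≤ (D n : ℝ) := (hbig j hj₀j).trans (by exact_mod_cast hDmono hpow_le)
  -- `(2^{j+2})^σ ≥ (n/2)^σ`, so `log D n ≥ σ (log n - log 2)`
  have hn2 : (n : ℝ) / 2 ≤ (2 : ℝ) ^ (j + 2) := by
    have : (n : ℝ) < (2 : ℝ) ^ (j + 3) := by exact_mod_cast hn_lt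
    rw [pow_succ] at this; linarith
  have hDpos : (0 : ℝ) < D n := lt_of_lt_of_le (by positivity) hDn
  have hlogD : σ * (Real.log n - Real.log 2) ≤ Real.log (D n : ℝ) := by
    have h1 : Real.log (((n : ℝ) / 2) ^ σ) ≤ Real.log (D n : ℝ) :=
      Real.log_le_log (by positivity) ((Real.rpow_le_rpow (by positivity) hn2 hσ.le).trans hDn)
    rwa [Real.log_rpow (by positivity), Real.log_div (by positivity) (by norm_num)] at h1
  have hlogn2 : Real.log ((n : ℝ) + 2) - 1 ≤ Real.log (n : ℝ) := by
    have hq : Real.log ((n : ℝ) + 2) - Real.log n = Real.log (((n : ℝ) + 2) / n) := (Real.log_div (by positivity) (by positivity)).symm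
    have hq2 : Real.log (((n : ℝ) + 2) / n) ≤ ((n : ℝ) + 2) / n - 1 := Real.log_le_sub_one_of_pos (by positivity)
    have hq3 : ((n : ℝ) + 2) / n - 1 ≤ 1 := by
      rw [div_sub_one (by positivity), div_le_one (by positivity)]
      have : (2 : ℝ) ≤ 2 * n := by linarith
      have h4 : (4 : ℝ) ≤ (2 : ℝ) ^ (j₀ + 2) := by
        have : (2 : ℝ) ^ 2 ≤ (2 : ℝ) ^ (j₀ + 2) := pow_le_pow_right₀ (by norm_num) (by omega)
        norm_num at this; linarith
      have h5 : ((2 : ℕ) ^ (j₀ + 2) : ℝ) ≤ n := by exact_mod_cast hn₀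
      push_cast at h5
      linarith
    linarith
  have hlog2le : Real.log 2 ≤ 1 := by
    have := Real.log_le_sub_one_of_pos (show (0 : ℝ) < 2 by norm_num); linarith
  refine ENNReal.ofReal_le_ofReal ?_
  rw [le_div_iff₀ hlog2]
  have hσn : σ * (Real.log ((n : ℝ) + 2) - 1) ≤ σ * Real.log (n : ℝ) := mul_le_mul_of_nonneg_left hlogn2 hσ.le
  linarith [hlogD, hσn, hnε]

/-- **Kesten's planar IIC**: summable short-crossing bounds at `p_c(ℤ²) = 1/2` ⇒ `α⁻ ≥ σ`, unconditionally in the IIC hypotheses ((A2)□(9,77) by RSW).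
[cite: Kesten1986, Thm. (3)] [cite: AizenmanBurchard1999, Thm. 1.3] -/
theorem iicMeasure_chemical_exponent_ge_of_summable_shortCrossings_Z2 {σ : ℝ} (hσ : 0 < σ)
    (hsum : Summable fun j : ℕ => (bondPercolation (zdGraph 2) (criticalProbI 2)).real
      {ω : BondConfig (Site 2) | ∃ a ∈ innerBoundary (zdGraph 2) (box 2 (2 ^ j + 1)), ∃ v ∈ innerBoundary (zdGraph 2) (box 2 (2 ^ (j + 1))),
        (openGraph (ω ∩ ((↑(box 2 (2 ^ (j + 1))) : Set (Site 2)) \ ↑(box 2 (2 ^ j))).sym2)).edist a v ≤ ⌊((2 : ℝ) ^ (j + 1)) ^ σ⌋₊})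
    {ν : Measure (BondConfig (Site 2))} [IsProbabilityMeasure ν]
    (hν : ∀ (F : Finset (Sym2 (Site 2))) (E : Set (BondConfig (Site 2))), MeasurableSet E → DeterminedBy E ↑F →
      Tendsto (fun n : ℕ => (bondPercolation (zdGraph 2) (criticalProbI 2)).real (E ∩ siteToBoundary 2 n) /
        oneArmProb 2 (criticalProbI 2) n) atTop (𝓝 (ν.real E))) :
    ∃ αl : ℝ≥0∞, ENNReal.ofReal σ ≤ αl ∧ ∀ᵐ ω ∂ν,
      liminf (fun n => ENNReal.ofReal
        (Real.log (((⨅ v : {v : Site 2 // v ∉ box 2 n}, (openGraph ω).edist (0 : Site 2) v.1).toNat : ℕ) : ℝ) /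
          Real.log ((n : ℝ) + 2))) atTop = αl := by
  obtain ⟨ϰ, hϰ, hA2⟩ := exists_setToSetQuasiMultAspectAt_two_of_criticalProbI_le
  exact iicMeasure_chemical_exponent_ge_of_summable_shortCrossings (d := 2) le_rfl (by norm_num) (by norm_num) hϰ (hA2 _ le_rfl) hσ hsum hν

end Summit.CriticalPhenomena.PercolationContinuityZ3.Theorems.Crossing

end
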